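import Summits.ResolutionOfSingularities.ResolutionOfSingularities.Theorems.LossPolygon
import HarnessLib

/-!
# LossPolygon2 — §4 the vertex invariants `(α, β)`, `(δ, γ⁻)`, `(ε, ζ)` of a finite point set and their laws under `Ψ₍₀:₁₎`/`Ψ₍₁:₀₎`;
§5 the walk-level vertex laws and the `β + ζ` clock at an untranslated plateau move (slice 2 of lens-3 g27 `LossPolygon.lean`, (P1)/(P2) tools
of the g28 window (W2″); see slice 1 for the dictionary).  [CJS2020] = Cossart–Jannsen–Saito, LNM 2270, Def. 11.1, Lemmas 12.1/12.2, Prop. 13.5.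
-/

open MvPolynomial Finset
open Literature.AlgebraicGeometry.Resolution
open Literature.AlgebraicGeometry.Resolution.Hauser2010
open Literature.AlgebraicGeometry.Resolution.PointBlowup
open Summit.ResolutionOfSingularities.ResolutionOfSingularities.Theorems.TightDefectClasses
open Summit.ResolutionOfSingularities.ResolutionOfSingularities.Theorems.TightDefectStrongWalks
open Summit.ResolutionOfSingularities.ResolutionOfSingularities.Theorems.ItineraryCutClasses
open Summit.ResolutionOfSingularities.ResolutionOfSingularities.Theorems.BoundaryLedger
open Summit.ResolutionOfSingularities.ResolutionOfSingularities.Theorems.ProximityCut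
open Summit.ResolutionOfSingularities.ResolutionOfSingularities.Theorems.LossExitCone

namespace Summit.ResolutionOfSingularities.ResolutionOfSingularities.Theorems.LossPolygon

variable {K : Type} [Field K] [DecidableEq K]
variable {q : ℕ} {s₀ : State (Fin 3) K}

/-! ## §4 The vertex invariants `v = (α, β)` and `(δ, γ⁻)` of a point set and their laws under `Ψ`

[CJS2020 Def. 11.1: `v(Δ)` = the leftmost point of the polygon, lowest among the leftmost, `(α, β)` its coordinates;
`δ = min (x₁ + x₂)`; `γ⁻ = min {x₂ : x₁ + x₂ = δ}`.  Lemma 12.1: under `(1:0)`, `α' = δ − 1`, `β' = γ⁻ (≤ β)`;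
Lemma 12.2: under `(0:1)`, `α' = α`, `β' = α + β − 1`.]  Here for the finite generating set `S` (the polygon's vertex is a
generator, so the values agree with the polyhedron's); junk value `0` on `S = ∅`. -/

section Vertex

variable {S : Finset (ℚ × ℚ)} {v w : ℚ × ℚ}

/-- The lexicographically least point of `S` — the VERTEX `v = (α, β)` [CJS2020 Def. 11.1 (1)]; `0` if `S = ∅`. [new] -/
def vertexOf (S : Finset (ℚ × ℚ)) : ℚ × ℚ :=
  if h : S.Nonempty then ofLex ((S.image toLex).min' (h.image toLex)) else 0

/-- `α(S)` = abscissa of the vertex = least `x₁` [CJS2020 Def. 11.1 (1)]. [new] -/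
def alphaOf (S : Finset (ℚ × ℚ)) : ℚ := (vertexOf S).1

/-- `β(S)` = ordinate of the vertex [CJS2020 Def. 11.1 (1)]. [new] -/
def betaOf (S : Finset (ℚ × ℚ)) : ℚ := (vertexOf S).2

/-- Skewed coordinates `(x₁ + x₂, x₂)`: their lexicographic minimum over `S` is `(δ, γ⁻)`. [new] -/
def skew (x : ℚ × ℚ) : ℚ × ℚ := (x.1 + x.2, x.2)

/-- `(δ(S), γ⁻(S))` [CJS2020 Def. 11.1 (2),(3)]. [new] -/
def dVertexOf (S : Finset (ℚ × ℚ)) : ℚ × ℚ := vertexOf (S.image skew)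

/-- `δ(S) = min (x₁ + x₂)`. [new] -/
def deltaOf (S : Finset (ℚ × ℚ)) : ℚ := (dVertexOf S).1

/-- `γ⁻(S) = min {x₂ : x₁ + x₂ = δ}`. [new] -/
def gammaMinusOf (S : Finset (ℚ × ℚ)) : ℚ := (dVertexOf S).2

/-- `skew_apply`: Auxiliary computation rule of the polygon calculus, VERBATIM from the lens file (docstring added by the writer for the gate's docstring lint); the statement is its type. [new; elementary] [folklore] -/
theorem skew_apply (x : ℚ × ℚ) : skew x = (x.1 + x.2, x.2) := rfl

/-- The vertex is a point of `S`. [folklore] -/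
theorem vertexOf_mem (h : S.Nonempty) : vertexOf S ∈ S := by
  unfold vertexOf
  rw [dif_pos h]
  obtain ⟨x, hx, hxe⟩ := Finset.mem_image.mp (Finset.min'_mem (S.image toLex) (h.image toLex))
  rw [← hxe]
  exact hx

/-- The vertex is lexicographically below every point of `S`. [folklore] -/
theorem vertexOf_le (hw : w ∈ S) : toLex (vertexOf S) ≤ toLex w := by
  have h : S.Nonempty := ⟨w, hw⟩
  unfold vertexOf
  rw [dif_pos h]
  exact Finset.min'_le _ _ (Finset.mem_image_of_mem toLex hw)

/-- Characterisation of the vertex: the lexicographically least point. [folklore] -/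
theorem vertexOf_eq (hv : v ∈ S) (hmin : ∀ w ∈ S, toLex v ≤ toLex w) : vertexOf S = v := by
  have h1 : toLex (vertexOf S) ≤ toLex v := vertexOf_le hv
  have h2 : toLex v ≤ toLex (vertexOf S) := hmin _ (vertexOf_mem ⟨v, hv⟩)
  exact toLex_inj.mp (le_antisymm h1 h2)

/-- The lexicographic order on `ℚ × ℚ`, unfolded. [folklore] -/
theorem toLex_le_toLex_iff (x y : ℚ × ℚ) : toLex x ≤ toLex y ↔ x.1 < y.1 ∨ (x.1 = y.1 ∧ x.2 ≤ y.2) :=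
  Prod.Lex.le_iff

/-- **Law of the vertex under `Ψ₍₀:₁₎` (PROVED): `v(Ψ₍₀:₁₎ S) = Ψ₍₀:₁₎ (v S)`, i.e. `α' = α`, `β' = α + β − 1`.**
[CJS2020 Lemma 12.2, for finite generating sets] -/
theorem vertexOf_image_psi01 (h : S.Nonempty) : vertexOf (S.image psi01) = psi01 (vertexOf S) := by
  classical
  refine vertexOf_eq (Finset.mem_image_of_mem _ (vertexOf_mem h)) fun w hw => ?_
  obtain ⟨x, hx, rfl⟩ := Finset.mem_image.mp hw
  have hle := vertexOf_le hx
  rw [toLex_le_toLex_iff] at hle ⊢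
  simp only [psi01]
  rcases hle with h1 | ⟨h1, h2⟩
  · exact Or.inl h1
  · exact Or.inr ⟨h1, by linarith⟩

/-- `alphaOf_image_psi01`: Auxiliary computation rule of the polygon calculus, VERBATIM from the lens file (docstring added by the writer for the gate's docstring lint); the statement is its type. [new; elementary] [folklore] -/
theorem alphaOf_image_psi01 (h : S.Nonempty) : alphaOf (S.image psi01) = alphaOf S := by
  unfold alphaOf; rw [vertexOf_image_psi01 h]; rfl

/-- `β' = α + β − 1` under `Ψ₍₀:₁₎`: the vertex ordinate DROPS BY EXACTLY `1 − α`. [CJS2020 Lemma 12.2] -/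
theorem betaOf_image_psi01 (h : S.Nonempty) : betaOf (S.image psi01) = alphaOf S + betaOf S - 1 := by
  unfold betaOf alphaOf; rw [vertexOf_image_psi01 h]; rfl

/-- Hence `β` strictly drops under `Ψ₍₀:₁₎` iff `α < 1` (quasi-isolation along the `u₂`-axis). [CJS2020 Lemma 12.2 + (11.3)] -/
theorem betaOf_image_psi01_lt_iff (h : S.Nonempty) : betaOf (S.image psi01) < betaOf S ↔ alphaOf S < 1 := by
  rw [betaOf_image_psi01 h]
  constructor <;> intro hh <;> linarith

/-- `(δ, γ⁻)` is realised by a point of `S`. [folklore] -/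
theorem exists_skew_eq_dVertexOf (h : S.Nonempty) : ∃ x ∈ S, skew x = dVertexOf S := by
  classical
  exact Finset.mem_image.mp (vertexOf_mem (S := S.image skew) (h.image skew))

/-- `(δ, γ⁻)` is lexicographically below `(x₁ + x₂, x₂)` for every point. [folklore] -/
theorem dVertexOf_le (hw : w ∈ S) : toLex (dVertexOf S) ≤ toLex (skew w) := by
  classical
  exact vertexOf_le (Finset.mem_image_of_mem skew hw)

/-- **Law of the vertex under `Ψ₍₁:₀₎` (PROVED): `v(Ψ₍₁:₀₎ S) = (δ − 1, γ⁻)`.** [CJS2020 Lemma 12.1, for finite generating sets] -/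
theorem vertexOf_image_psi10 (h : S.Nonempty) : vertexOf (S.image psi10) = (deltaOf S - 1, gammaMinusOf S) := by
  classical
  obtain ⟨x, hx, hxe⟩ := exists_skew_eq_dVertexOf h
  have hx10 : psi10 x = (deltaOf S - 1, gammaMinusOf S) := by
    unfold deltaOf gammaMinusOf
    rw [← hxe]
    rfl
  rw [← hx10]
  refine vertexOf_eq (Finset.mem_image_of_mem _ hx) fun w hw => ?_
  obtain ⟨y, hy, rfl⟩ := Finset.mem_image.mp hw
  have hle := dVertexOf_le hy
  rw [← hxe, toLex_le_toLex_iff] at hle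
  rw [toLex_le_toLex_iff]
  simp only [skew] at hle
  simp only [psi10]
  rcases hle with h1 | ⟨h1, h2⟩
  · exact Or.inl (by linarith)
  · exact Or.inr ⟨by linarith, h2⟩

/-- `α' = δ − 1` under `Ψ₍₁:₀₎`. [CJS2020 Lemma 12.1] -/
theorem alphaOf_image_psi10 (h : S.Nonempty) : alphaOf (S.image psi10) = deltaOf S - 1 := by
  unfold alphaOf; rw [vertexOf_image_psi10 h]

/-- `β' = γ⁻` under `Ψ₍₁:₀₎`. [CJS2020 Lemma 12.1] -/
theorem betaOf_image_psi10 (h : S.Nonempty) : betaOf (S.image psi10) = gammaMinusOf S := by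
  unfold betaOf; rw [vertexOf_image_psi10 h]

/-- `δ ≤ α + β` (the vertex lies on or above the `δ`-line). [folklore] -/
theorem deltaOf_le (h : S.Nonempty) : deltaOf S ≤ alphaOf S + betaOf S := by
  have hle := dVertexOf_le (vertexOf_mem h)
  rw [toLex_le_toLex_iff] at hle
  unfold deltaOf alphaOf betaOf
  simp only [skew] at hle
  rcases hle with h1 | ⟨h1, _⟩
  · exact le_of_lt h1
  · exact le_of_eq h1

/-- **`γ⁻ ≤ β` (PROVED): under `Ψ₍₁:₀₎` the vertex ordinate does not increase.** [CJS2020, proof of Prop. 13.5 (β non-increasing)] -/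
theorem gammaMinusOf_le_betaOf (h : S.Nonempty) : gammaMinusOf S ≤ betaOf S := by
  obtain ⟨x, hx, hxe⟩ := exists_skew_eq_dVertexOf h
  -- `(δ, γ⁻) = skew x ≤ₗₑₓ skew v` and `v ≤ₗₑₓ x`
  have h1 := dVertexOf_le (S := S) (vertexOf_mem h)
  have h2 := vertexOf_le (S := S) hx
  rw [← hxe, toLex_le_toLex_iff] at h1
  rw [toLex_le_toLex_iff] at h2
  unfold gammaMinusOf betaOf
  rw [← hxe]
  simp only [skew] at h1 ⊢
  change x.2 ≤ (vertexOf S).2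
  rcases h1 with h1 | ⟨h1, h1'⟩
  · rcases h2 with h2 | ⟨h2, h2'⟩
    · linarith
    · linarith
  · exact h1'

/-- Under `Ψ₍₁:₀₎` the vertex ordinate is non-increasing. [CJS2020 Prop. 13.5] -/
theorem betaOf_image_psi10_le (h : S.Nonempty) : betaOf (S.image psi10) ≤ betaOf S := by
  rw [betaOf_image_psi10 h]; exact gammaMinusOf_le_betaOf h

/-- Under `Ψ₍₀:₁₎` the vertex ordinate is non-increasing as soon as `α ≤ 1`. [CJS2020 Prop. 13.5] -/
theorem betaOf_image_psi01_le (h : S.Nonempty) (hα : alphaOf S ≤ 1) : betaOf (S.image psi01) ≤ betaOf S := by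
  rw [betaOf_image_psi01 h]; linarith

/-! ### The mirror invariants `(ε, ζ)` = `(α, β)` of the swapped set, and their laws -/

/-- `ε(S)` = least `x₂` [CJS2020 Def. 11.1 (5)]. [new] -/
def epsOf (S : Finset (ℚ × ℚ)) : ℚ := alphaOf (S.image Prod.swap)

/-- `ζ(S)` = least `x₁` among the points with `x₂ = ε` [CJS2020 Def. 11.1 (w⁺)]. [new] -/
def zetaOf (S : Finset (ℚ × ℚ)) : ℚ := betaOf (S.image Prod.swap)

/-- `image_swap_image_psi01`: Auxiliary computation rule of the polygon calculus, VERBATIM from the lens file (docstring added by the writer for the gate's docstring lint); the statement is its type. [new; elementary] [folklore] -/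
theorem image_swap_image_psi01 (S : Finset (ℚ × ℚ)) :
    (S.image psi01).image Prod.swap = (S.image Prod.swap).image psi10 := by
  classical
  rw [Finset.image_image, Finset.image_image]
  refine Finset.image_congr fun x _ => ?_
  show Prod.swap (psi01 x) = psi10 (Prod.swap x)
  rw [psi10_eq_swap, Prod.swap_swap]

/-- `image_swap_image_psi10`: Auxiliary computation rule of the polygon calculus, VERBATIM from the lens file (docstring added by the writer for the gate's docstring lint); the statement is its type. [new; elementary] [folklore] -/
theorem image_swap_image_psi10 (S : Finset (ℚ × ℚ)) :
    (S.image psi10).image Prod.swap = (S.image Prod.swap).image psi01 := by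
  classical
  rw [Finset.image_image, Finset.image_image]
  refine Finset.image_congr fun x _ => ?_
  show Prod.swap (psi10 x) = psi01 (Prod.swap x)
  rw [psi10_eq_swap, Prod.swap_swap]

/-- Under `Ψ₍₁:₀₎`: `ε' = ε`, `ζ' = ε + ζ − 1` — `ζ` DROPS BY EXACTLY `1 − ε`. [CJS2020 Lemma 12.1 (ζ-part)] -/
theorem epsOf_image_psi10 (h : S.Nonempty) : epsOf (S.image psi10) = epsOf S := by
  classical
  unfold epsOf; rw [image_swap_image_psi10, alphaOf_image_psi01 (h.image _)]

/-- `zetaOf_image_psi10`: Auxiliary computation rule of the polygon calculus, VERBATIM from the lens file (docstring added by the writer for the gate's docstring lint); the statement is its type. [new; elementary] [folklore] -/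
theorem zetaOf_image_psi10 (h : S.Nonempty) : zetaOf (S.image psi10) = epsOf S + zetaOf S - 1 := by
  classical
  unfold zetaOf epsOf; rw [image_swap_image_psi10, betaOf_image_psi01 (h.image _)]

/-- Under `Ψ₍₀:₁₎`: `ζ` is non-increasing (`ζ' = δ − γ⁺ ≤ ζ`). [CJS2020, mirror of Prop. 13.5] -/
theorem zetaOf_image_psi01_le (h : S.Nonempty) : zetaOf (S.image psi01) ≤ zetaOf S := by
  classical
  unfold zetaOf; rw [image_swap_image_psi01]; exact betaOf_image_psi10_le (h.image _)

/-- Under `Ψ₍₁:₀₎`: `ζ` is non-increasing as soon as `ε ≤ 1`, strictly iff `ε < 1`. [CJS2020 Lemma 12.1] -/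
theorem zetaOf_image_psi10_lt_iff (h : S.Nonempty) : zetaOf (S.image psi10) < zetaOf S ↔ epsOf S < 1 := by
  rw [zetaOf_image_psi10 h]
  constructor <;> intro hh <;> linarith

/-- **THE SUM `β + ζ` DROPS BY AT LEAST `1 − α` UNDER `Ψ₍₀:₁₎` AND BY AT LEAST `1 − ε` UNDER `Ψ₍₁:₀₎` (PROVED)** — so on a
stretch of untranslated plateau letters with `α, ε < 1` (F-isolation) the rational `β + ζ ∈ (1/L)ℕ` is a strictly
decreasing clock (SEED-g28 §1 (B″) (M1)–(M3)). [new; CJS2020 Lemmas 12.1/12.2 combined] -/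
theorem betaOf_add_zetaOf_image_psi01 (h : S.Nonempty) :
    betaOf (S.image psi01) + zetaOf (S.image psi01) ≤ betaOf S + zetaOf S - (1 - alphaOf S) := by
  have h1 := betaOf_image_psi01 h
  have h2 := zetaOf_image_psi01_le h
  linarith

/-- `betaOf_add_zetaOf_image_psi10`: Auxiliary computation rule of the polygon calculus, VERBATIM from the lens file (docstring added by the writer for the gate's docstring lint); the statement is its type. [new; elementary] [folklore] -/
theorem betaOf_add_zetaOf_image_psi10 (h : S.Nonempty) :
    betaOf (S.image psi10) + zetaOf (S.image psi10) ≤ betaOf S + zetaOf S - (1 - epsOf S) := by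
  have h1 := betaOf_image_psi10_le h
  have h2 := zetaOf_image_psi10 h
  linarith

end Vertex

/-! ## §5 The walk-level vertex laws at an untranslated plateau move (composition of §3 and §4) -/

section WalkLaws

variable {a b c : Fin 3} {s : ℕ}

/-- **R-LETTER / REPEAT LAW (chart of the second frame letter; CJS `(0:1)`): `α' = α`, `β' = α + β − 1`, `ζ' ≤ ζ`.**
[CJS2020 Lemma 12.2 for the walk; new] -/
theorem vertex_polyPts_succ_chart_snd (hs : IsRoot q s₀) (W : ForcedWalk q s₀) (t : ℕ) (hab : a ≠ b) (hac : a ≠ c) (hbc : b ≠ c) (hj : W.j t = b) (hb : W.b t = 0)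
    (hra : (W.st (t + 1)).r a = (W.st t).r a) (hrb : (W.st (t + 1)).r b + q = s + (W.st t).r a + (W.st t).r b)
    (hrc : (W.st t).r c = 0) (hrc' : (W.st (t + 1)).r c = 0) (hne : (polyPts s (W.st t).r a b c (W.st t).F).Nonempty) :
    alphaOf (polyPts s (W.st (t + 1)).r a b c (W.st (t + 1)).F) = alphaOf (polyPts s (W.st t).r a b c (W.st t).F) ∧
    betaOf (polyPts s (W.st (t + 1)).r a b c (W.st (t + 1)).F) =
      alphaOf (polyPts s (W.st t).r a b c (W.st t).F) + betaOf (polyPts s (W.st t).r a b c (W.st t).F) - 1 ∧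
    zetaOf (polyPts s (W.st (t + 1)).r a b c (W.st (t + 1)).F) ≤ zetaOf (polyPts s (W.st t).r a b c (W.st t).F) := by
  rw [polyPts_succ_chart_snd hs W t hab hac hbc hj hb hra hrb hrc hrc']
  exact ⟨alphaOf_image_psi01 hne, betaOf_image_psi01 hne, zetaOf_image_psi01_le hne⟩

/-- **KEPT-EXIT LAW, untranslated (chart of the first frame letter; CJS `(1:0)`): `α' = δ − 1`, `β' = γ⁻ ≤ β`, `ε' = ε`,
`ζ' = ε + ζ − 1`.** [CJS2020 Lemma 12.1 for the walk; new] -/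
theorem vertex_polyPts_succ_chart_fst (hs : IsRoot q s₀) (W : ForcedWalk q s₀) (t : ℕ) (hab : a ≠ b) (hac : a ≠ c) (hbc : b ≠ c) (hj : W.j t = a) (hb : W.b t = 0)
    (hrb : (W.st (t + 1)).r b = (W.st t).r b) (hra : (W.st (t + 1)).r a + q = s + (W.st t).r a + (W.st t).r b)
    (hrc : (W.st t).r c = 0) (hrc' : (W.st (t + 1)).r c = 0) (hne : (polyPts s (W.st t).r a b c (W.st t).F).Nonempty) :
    alphaOf (polyPts s (W.st (t + 1)).r a b c (W.st (t + 1)).F) = deltaOf (polyPts s (W.st t).r a b c (W.st t).F) - 1 ∧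
    betaOf (polyPts s (W.st (t + 1)).r a b c (W.st (t + 1)).F) = gammaMinusOf (polyPts s (W.st t).r a b c (W.st t).F) ∧
    betaOf (polyPts s (W.st (t + 1)).r a b c (W.st (t + 1)).F) ≤ betaOf (polyPts s (W.st t).r a b c (W.st t).F) ∧
    epsOf (polyPts s (W.st (t + 1)).r a b c (W.st (t + 1)).F) = epsOf (polyPts s (W.st t).r a b c (W.st t).F) ∧
    zetaOf (polyPts s (W.st (t + 1)).r a b c (W.st (t + 1)).F) =
      epsOf (polyPts s (W.st t).r a b c (W.st t).F) + zetaOf (polyPts s (W.st t).r a b c (W.st t).F) - 1 := by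
  rw [polyPts_succ_chart_fst hs W t hab hac hbc hj hb hrb hra hrc hrc']
  exact ⟨alphaOf_image_psi10 hne, betaOf_image_psi10 hne, betaOf_image_psi10_le hne, epsOf_image_psi10 hne,
    zetaOf_image_psi10 hne⟩

/-- **THE CLOCK (PROVED): along an untranslated plateau letter in either frame chart the rational `β + ζ` drops by at
least `1 − α` (chart `b`) resp. `1 − ε` (chart `a`).** [new] -/
theorem clock_polyPts_succ_chart_snd (hs : IsRoot q s₀) (W : ForcedWalk q s₀) (t : ℕ) (hab : a ≠ b) (hac : a ≠ c) (hbc : b ≠ c) (hj : W.j t = b) (hb : W.b t = 0)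
    (hra : (W.st (t + 1)).r a = (W.st t).r a) (hrb : (W.st (t + 1)).r b + q = s + (W.st t).r a + (W.st t).r b)
    (hrc : (W.st t).r c = 0) (hrc' : (W.st (t + 1)).r c = 0) (hne : (polyPts s (W.st t).r a b c (W.st t).F).Nonempty) :
    betaOf (polyPts s (W.st (t + 1)).r a b c (W.st (t + 1)).F) + zetaOf (polyPts s (W.st (t + 1)).r a b c (W.st (t + 1)).F) ≤
      betaOf (polyPts s (W.st t).r a b c (W.st t).F) + zetaOf (polyPts s (W.st t).r a b c (W.st t).F) -
        (1 - alphaOf (polyPts s (W.st t).r a b c (W.st t).F)) := by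
  rw [polyPts_succ_chart_snd hs W t hab hac hbc hj hb hra hrb hrc hrc']
  exact betaOf_add_zetaOf_image_psi01 hne

/-- `clock_polyPts_succ_chart_fst`: Auxiliary computation rule of the polygon calculus, VERBATIM from the lens file (docstring added by the writer for the gate's docstring lint); the statement is its type. [new; elementary] [folklore] -/
theorem clock_polyPts_succ_chart_fst (hs : IsRoot q s₀) (W : ForcedWalk q s₀) (t : ℕ) (hab : a ≠ b) (hac : a ≠ c) (hbc : b ≠ c) (hj : W.j t = a) (hb : W.b t = 0)
    (hrb : (W.st (t + 1)).r b = (W.st t).r b) (hra : (W.st (t + 1)).r a + q = s + (W.st t).r a + (W.st t).r b)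
    (hrc : (W.st t).r c = 0) (hrc' : (W.st (t + 1)).r c = 0) (hne : (polyPts s (W.st t).r a b c (W.st t).F).Nonempty) :
    betaOf (polyPts s (W.st (t + 1)).r a b c (W.st (t + 1)).F) + zetaOf (polyPts s (W.st (t + 1)).r a b c (W.st (t + 1)).F) ≤
      betaOf (polyPts s (W.st t).r a b c (W.st t).F) + zetaOf (polyPts s (W.st t).r a b c (W.st t).F) -
        (1 - epsOf (polyPts s (W.st t).r a b c (W.st t).F)) := by
  rw [polyPts_succ_chart_fst hs W t hab hac hbc hj hb hrb hra hrc hrc']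
  exact betaOf_add_zetaOf_image_psi10 hne

end WalkLaws

end Summit.ResolutionOfSingularities.ResolutionOfSingularities.Theorems.LossPolygon
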